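import Literature.MathematicalPhysics.QuantumFieldTheory.Balaban1983to89.Node00.CarriersB8
import Literature.MathematicalPhysics.QuantumFieldTheory.Balaban1983to89.Node00.Record12Carriers

/-!
# BalabanUVNodes ∕ N08 RECORD-STAGE-GENERIC — `Dag.B10_main` at ANY world bound over ANY [B10]-pinned Stage-5 view, from the one slot
# instance `Node00.PrintedUV3V N L` (Track A, DAG node N08 [Balaban1985UV3] CMP **102** (1985) 255, Thm 1 p. 257 (compact reading) + Thm 2 p. 272;
# R134 fan-out seat `pub-ymgap-dag-n08-c` g6, strategy s2 «knit at the record of record», 2026-08-27; trigger (t5) = def-T's `Node00/Record13`)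

WHY THIS FILE.  Every NODE 00 record stage ₅C, ₈CB10, ₉CB10(Y), ₁₀CB10YZ(W)(B8), ₁₁CB10YZW(B8), ₁₂C(B10YZW(B8)), ₁₃C … binds its world's upstream block at run `P`
through ONE function, node00-def g28's C-binding `Node00.upOfRecord₅C F N v P` (or n05-a's S-binding `Node00.upOfRecord₅CS F N v P`), over SOME Stage-5 view
`v : Node00.Stage5Params F N` of the stage's parameters (`θ.toStage5₉ ∕ ₁₀ ∕ ₁₁ ∕ ₁₂ ∕ ₁₃ …`, then pinned: `Stage5Params.pinB10 ∕ pinY ∕ pinZ ∕ pinW ∕ pinB8`, node00-def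
g29–g31).  N08's node `Dag.B10_main ℓ := ℓ.b5 → ℓ.b6 → ℓ.b7 → ℓ.b8 → ℓ.b9 → ℓ.b11 → ℓ.b10` reads ONE leaf, `b10`, and the [B10] pin makes that leaf THE SLOT OF RECORD
`Node00.PrintedUV3V N v.L` (g29's `Node00.upOfRecord₅C_pinB10_b10_iff`), a face the Y ∕ Z ∕ W ∕ [B8] pins do not touch (g29–g31's `upOfRecord₅C_pinY_b10`, `…_pinZ_b10`,
`…_pinW_b9_b10_b11`, `…_pinB8_b10_iff`).  So N08's storey at a record stage is NOT stage-specific: this seat's ₉ ∕ ₁₀ ∕ ₁₁ ∕ ₁₂ twins (`BalabanUVNodesN08AtRecord9CB10`,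
`…10CB10YZ`, `…11`, `…12`, `…N08StubNodes12Currency` §1) each re-proved the same three lines over that stage's named view.  HERE the three lines are proved
ONCE over an ARBITRARY view with the `b10` face as the only hypothesis (§1), the face is supplied for the pin WORDS over a generic `σ : Stage5Params` (§2), and
the pointed closers every later stage consumes are composed (§3) — at stage ₙ (₁₃ today: `θ.toStage5₁₃`, def-T `Node00/Record13` p486037; the ₁₃ carrier stack is
not yet in the tree) N08's storey is ONE `exact` per view, whatever the stage's histories ∕ β ∕ χ species (the [B10] group is history-free: its lattices, minimisers
and transformations are [Balaban1985UV3]'s own, `Node00.runsB10OfRecord N L`).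

WHAT THIS FILE PROVES (kernel bookkeeping BY NAME; 0 `def`, 0 `sorry`).
* §1 AT A BOUND WORLD, GENERIC: for `w.up P = u` and ANY reading `u.b10 ↔ S` of the bound block's `b10` leaf — `b10_leaf_iff_of_up_eq`, `b10_main_iff_of_up_eq`
  (N08 ⟺ «in-edge leaves → S»), `b10_main_of_up_eq` (N08 ⟸ S; no datum, window, in-edge or residual-layer hypothesis), and the ∀-run forms over a view
  `v : Stage5Params` with face `∀ P, (upOfRecord₅C F N v P).b10 ↔ S` (`b10_main_of_up_of_face`, S-binding twin `b10_main_of_upS_of_face`).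
* §2 THE `b10` FACE OVER THE PIN WORDS, generic `σ : Stage5Params F N`: transport of a face along `pinY ∕ pinZ ∕ pinW ∕ pinB8` and to the S-binding
  (`b10Face_pinY ∕ _pinZ ∕ _pinW ∕ _pinB8 ∕ b10FaceS_of_b10Face`), the four-pin word `b10Face_pin4 : (upOfRecord₅C F N ((((σ.pinB10).pinY Y₀).pinZ Z₀).pinW W₀) P).b10 ↔
  PrintedUV3V N σ.L` for EVERY `Y₀ Z₀ W₀` (the cumulative views `view₉ ∕ ₁₀ ∕ ₁₁ ∕ ₁₂B10YZW` are its instances at `σ := θ.toStage5ₙ`, `Y₀ := Y9OfRecord …`, `Z₀ := Z11OfRecord ζ`,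
  `W₀ := WOfRecordₙ θ λW`), the [B8]-inner five-pin word `b10Face_pinB8_pin4` (the `…B8B10YZW` views) and their S-binding forms.
* §3 POINTED CLOSERS: `b10_main_of_up_pinB10 ∕ _pin4 ∕ _pinB8_pin4` (C-binding) and `b10_main_of_upS_pinB8_pin4` (S-binding): at a world bound over the pinned view,
  `Dag.B10_main (leavesP w P)` from `PrintedUV3V N σ.L`; exact readings `b10_leaf_iff_of_up_pin4 ∕ _pinB8_pin4`.
HONEST FRAMING: count-neutral; nothing of Bałaban's asserted; `Node00.PrintedUV3V` («SOME version of print's transformations (2) carries [Balaban1985UV3] Thm 1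
(compact reading) ∧ Thm 2 with their printed ∃-prefix, on SU(N), block size `L`») is TYPED, NOT PROVED — an inhabitant of it remains THE object gap of N08; N08 NOT
discharged; one finite four-torus per run at fixed `ε`, [B10]'s d = 3 lattices inside the record; nothing continuum ∕ ℝ⁴ ∕ OS ∕ mass gap ∕ Clay.  Filed `--supports`
the (B)-side crux K1′ `StabilityBAtRecordR12e` (stmt-QuantumFields-19903) as a helper (transfer by name to rev 16's K1″).
Sources: [Balaban1985UV3] Thm 1 p.257, Thm 2 p.272; [Balaban1989LargeFieldII] Thm 1 + (0.1) pp.355–356 (the record's world; bookkeeping).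
-/

noncomputable section

namespace Summit.QuantumFields.YangMills.BalabanUVNodes.N08AtStage5View

open Literature.MathematicalPhysics.QuantumFieldTheory.Balaban1983to89
open Literature.MathematicalPhysics.QuantumFieldTheory.Balaban1983to89.T4Continuum (T4Family)
open Literature.MathematicalPhysics.QuantumFieldTheory.Balaban1983to89.DagBinding
  (WorldP leavesP Upstream PrintedCarriers9X PrintedCarriers11 PrintedCarriers15)
open Literature.MathematicalPhysics.QuantumFieldTheory.Balaban1983to89.Node00
open scoped Matrix.Norms.L2Operator

variable {F : T4Family} {N : ℕ} [NeZero N]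

/-! ## §1 N08 AT A BOUND WORLD, GENERIC IN THE BOUND BLOCK AND IN THE READING OF ITS `b10` LEAF -/

section Generic
variable {w : WorldP} {P : B12.RunParams} {u : Upstream} {S : Prop}

/-- **EXACT READING, generic**: if the world's block at `P` is `u` and `u.b10 ↔ S`, the run's `b10` leaf IS `S`. [cite: Balaban1985UV3, Thm 1 p.257, Thm 2 p.272 (bookkeeping: the leaf's binding)] -/
theorem b10_leaf_iff_of_up_eq (hup : w.up P = u) (hb10 : u.b10 ↔ S) : (leavesP w P).b10 ↔ S := by
  show (w.up P).b10 ↔ S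
  rw [hup]
  exact hb10

/-- **EXACT COST of N08 at such a run**: `Dag.B10_main` ⟺ «the run's in-edge leaves `b5 b6 b7 b8 b9 b11` ⟹ `S`». [cite: Balaban1985UV3, Thm 1 p.257, Thm 2 p.272 (bookkeeping)] -/
theorem b10_main_iff_of_up_eq (hup : w.up P = u) (hb10 : u.b10 ↔ S) :
    Dag.B10_main (leavesP w P) ↔
      ((leavesP w P).b5 → (leavesP w P).b6 → (leavesP w P).b7 → (leavesP w P).b8 → (leavesP w P).b9 → (leavesP w P).b11 → S) := by
  unfold Dag.B10_main
  rw [b10_leaf_iff_of_up_eq hup hb10]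

/-- **N08 at such a run FROM `S`** (in-edges unused; no datum, window or residual-layer hypothesis). [cite: Balaban1985UV3, Thm 1 p.257, Thm 2 p.272 (bookkeeping)] -/
theorem b10_main_of_up_eq (hup : w.up P = u) (hb10 : u.b10 ↔ S) (hS : S) : Dag.B10_main (leavesP w P) :=
  fun _ _ _ _ _ _ => (b10_leaf_iff_of_up_eq hup hb10).2 hS

/-- Conversely, at such a run N08 together with its in-edge leaves GIVES `S` (the node is not idle). [cite: Balaban1985UV3, Thm 1 p.257, Thm 2 p.272 (bookkeeping)] -/
theorem of_b10_main_of_up_eq (hup : w.up P = u) (hb10 : u.b10 ↔ S) (h : Dag.B10_main (leavesP w P)) (h5 : (leavesP w P).b5) (h6 : (leavesP w P).b6)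
    (h7 : (leavesP w P).b7) (h8 : (leavesP w P).b8) (h9 : (leavesP w P).b9) (h11 : (leavesP w P).b11) : S :=
  (b10_leaf_iff_of_up_eq hup hb10).1 (h h5 h6 h7 h8 h9 h11)

end Generic

section Face
variable {w : WorldP} {v : Stage5Params F N} {S : Prop}

/-- **N08 AT EVERY RUN of a world bound by the C-binding of record over a view whose `b10` face reads `S`**, from `S`. [cite: Balaban1985UV3, Thm 1 p.257, Thm 2 p.272; Balaban1989LargeFieldII, Thm 1 + (0.1) pp.355–356 (bookkeeping: the record's world)] -/
theorem b10_main_of_up_of_face (hb10 : ∀ P, (upOfRecord₅C F N v P).b10 ↔ S) (hup : ∀ P, w.up P = upOfRecord₅C F N v P) (hS : S)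
    (P : B12.RunParams) : Dag.B10_main (leavesP w P) :=
  b10_main_of_up_eq (hup P) (hb10 P) hS

/-- … exact reading of the leaf at every run. [cite: Balaban1985UV3, Thm 1 p.257, Thm 2 p.272 (bookkeeping)] -/
theorem b10_leaf_iff_of_up_of_face (hb10 : ∀ P, (upOfRecord₅C F N v P).b10 ↔ S) (hup : ∀ P, w.up P = upOfRecord₅C F N v P) (P : B12.RunParams) :
    (leavesP w P).b10 ↔ S :=
  b10_leaf_iff_of_up_eq (hup P) (hb10 P)

/-- The S-binding's `b10` leaf IS the C-binding's (n05-a's `upOfRecord₅CS` re-binds `b8` only; `Iff.rfl` through the structure update). [cite: Balaban1985RegularSpaces, Thm 8 p.101 (bookkeeping: the re-bound leaf is `b8`)] -/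
theorem upOfRecord₅CS_b10_iff (v : Stage5Params F N) (P : B12.RunParams) : (upOfRecord₅CS F N v P).b10 ↔ (upOfRecord₅C F N v P).b10 := Iff.rfl

/-- A `b10` face of the C-binding IS a `b10` face of the S-binding. [cite: Balaban1985RegularSpaces, Thm 8 p.101 (bookkeeping)] -/
theorem b10FaceS_of_b10Face {P : B12.RunParams} (h : (upOfRecord₅C F N v P).b10 ↔ S) : (upOfRecord₅CS F N v P).b10 ↔ S := h

/-- **N08 AT EVERY RUN of a world bound by the S-binding over a view whose `b10` face reads `S`**, from `S`. [cite: Balaban1985UV3, Thm 1 p.257, Thm 2 p.272; Balaban1985RegularSpaces, Thm 8 p.101 (bookkeeping)] -/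
theorem b10_main_of_upS_of_face (hb10 : ∀ P, (upOfRecord₅C F N v P).b10 ↔ S) (hup : ∀ P, w.up P = upOfRecord₅CS F N v P) (hS : S)
    (P : B12.RunParams) : Dag.B10_main (leavesP w P) :=
  b10_main_of_up_eq (hup P) (b10FaceS_of_b10Face (hb10 P)) hS

end Face

/-! ## §2 THE `b10` FACE OVER THE PIN WORDS — generic `σ : Node00.Stage5Params F N` (node00-def g29–g31's single-pin faces BY NAME) -/

section PinWords
variable (σ : Stage5Params F N) {S : Prop} {P : B12.RunParams}

/-- A `b10` face survives the Y pin (g29∕def-Y's `upOfRecord₅C_pinY_b10`, `rfl`). [cite: Balaban1985BackgroundPropagators, Thm 3.1 p.397 (bookkeeping: the Y pin touches `b9` only)] -/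
theorem b10Face_pinY (Y₀ : PrintedCarriers9X) (h : (upOfRecord₅C F N σ P).b10 ↔ S) : (upOfRecord₅C F N (σ.pinY F N Y₀) P).b10 ↔ S := by
  rw [upOfRecord₅C_pinY_b10]; exact h

/-- A `b10` face survives the Z pin (g30's `upOfRecord₅C_pinZ_b10`, `rfl`). [cite: Balaban1985Variational, Thm 1 p.279 (bookkeeping: the Z pin touches `b11` only)] -/
theorem b10Face_pinZ (Z₀ : PrintedCarriers11) (h : (upOfRecord₅C F N σ P).b10 ↔ S) : (upOfRecord₅C F N (σ.pinZ F N Z₀) P).b10 ↔ S := by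
  rw [upOfRecord₅C_pinZ_b10]; exact h

/-- A `b10` face survives the W pin (g31's `upOfRecord₅C_pinW_b9_b10_b11`, `rfl`). [cite: Balaban1989LargeFieldI, (0.2) p.176 (bookkeeping: the W pin touches `rBasicStep` only)] -/
theorem b10Face_pinW (W₀ : B12.RunParams → PrintedCarriers15) (h : (upOfRecord₅C F N σ P).b10 ↔ S) :
    (upOfRecord₅C F N (σ.pinW F N W₀) P).b10 ↔ S := by
  rw [(upOfRecord₅C_pinW_b9_b10_b11 F N σ W₀ P).2.1]; exact h

/-- A `b10` face survives the [B8] pin (n05-a∕g31's `upOfRecord₅C_pinB8_b10_iff`). [cite: Balaban1985RegularSpaces, Thm 2 p.83 (bookkeeping: the [B8] pin touches `b8` only)] -/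
theorem b10Face_pinB8 (lam : ResidB8 σ.toStage3Params) (h : (upOfRecord₅C F N σ P).b10 ↔ S) : (upOfRecord₅C F N (σ.pinB8 F N lam) P).b10 ↔ S :=
  (upOfRecord₅C_pinB8_b10_iff F N σ lam P).trans h

/-- **THE FOUR-PIN WORD**: over `(((σ.pinB10).pinY Y₀).pinZ Z₀).pinW W₀` the C-binding's `b10` leaf IS `PrintedUV3V N σ.L`, for EVERY `Y₀ Z₀ W₀` (g29's [B10] face
`upOfRecord₅C_pinB10_b10_iff` carried through the three outer pins).  The cumulative views `view₉∕₁₀∕₁₁∕₁₂B10YZW` are instances (`σ := θ.toStage5ₙ`).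
[cite: Balaban1985UV3, Thm 1 p.257 (compact reading) + Thm 2 p.272] -/
theorem b10Face_pin4 (Y₀ : PrintedCarriers9X) (Z₀ : PrintedCarriers11) (W₀ : B12.RunParams → PrintedCarriers15) (P : B12.RunParams) :
    (upOfRecord₅C F N ((((σ.pinB10 F N).pinY F N Y₀).pinZ F N Z₀).pinW F N W₀) P).b10 ↔ PrintedUV3V N σ.L :=
  b10Face_pinW _ W₀ (b10Face_pinZ _ Z₀ (b10Face_pinY _ Y₀ (upOfRecord₅C_pinB10_b10_iff F N σ P)))

/-- **THE [B8]-INNER FIVE-PIN WORD**: over `((((σ.pinB8 λ).pinB10).pinY Y₀).pinZ Z₀).pinW W₀` the C-binding's `b10` leaf IS `PrintedUV3V N σ.L` (the `…B8B10YZW` views).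
[cite: Balaban1985UV3, Thm 1 p.257 (compact reading) + Thm 2 p.272] -/
theorem b10Face_pinB8_pin4 (lam : ResidB8 σ.toStage3Params) (Y₀ : PrintedCarriers9X) (Z₀ : PrintedCarriers11) (W₀ : B12.RunParams → PrintedCarriers15)
    (P : B12.RunParams) :
    (upOfRecord₅C F N (((((σ.pinB8 F N lam).pinB10 F N).pinY F N Y₀).pinZ F N Z₀).pinW F N W₀) P).b10 ↔ PrintedUV3V N σ.L :=
  b10Face_pin4 (σ.pinB8 F N lam) Y₀ Z₀ W₀ P

/-- … the same word read by the S-binding. [cite: Balaban1985UV3, Thm 1 p.257 + Thm 2 p.272; Balaban1985RegularSpaces, Thm 8 p.101 (bookkeeping)] -/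
theorem b10FaceS_pinB8_pin4 (lam : ResidB8 σ.toStage3Params) (Y₀ : PrintedCarriers9X) (Z₀ : PrintedCarriers11) (W₀ : B12.RunParams → PrintedCarriers15)
    (P : B12.RunParams) :
    (upOfRecord₅CS F N (((((σ.pinB8 F N lam).pinB10 F N).pinY F N Y₀).pinZ F N Z₀).pinW F N W₀) P).b10 ↔ PrintedUV3V N σ.L :=
  b10Face_pinB8_pin4 σ lam Y₀ Z₀ W₀ P

/-- The [B10]-pinned view's `b10` face in the S-binding. [cite: Balaban1985UV3, Thm 1 p.257 + Thm 2 p.272 (bookkeeping)] -/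
theorem b10FaceS_pinB10 (P : B12.RunParams) : (upOfRecord₅CS F N (σ.pinB10 F N) P).b10 ↔ PrintedUV3V N σ.L :=
  upOfRecord₅C_pinB10_b10_iff F N σ P

end PinWords

/-! ## §3 POINTED CLOSERS AT WORLDS BOUND OVER THE PINNED VIEWS — cost: the one slot instance `PrintedUV3V N σ.L` -/

section Pointed
variable {w : WorldP} (σ : Stage5Params F N)

/-- **N08 AT A RUN BOUND OVER THE [B10]-PINNED VIEW** `σ.pinB10` (any stage: `σ := θ.toStage5ₙ F N`), from `PrintedUV3V N σ.L`. [cite: Balaban1985UV3, Thm 1 p.257 (compact reading) + Thm 2 p.272; Balaban1989LargeFieldII, Thm 1 + (0.1) pp.355–356 (bookkeeping)] -/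
theorem b10_main_of_up_pinB10 {P : B12.RunParams} (hup : w.up P = upOfRecord₅C F N (σ.pinB10 F N) P) (hUV : PrintedUV3V N σ.L) :
    Dag.B10_main (leavesP w P) :=
  b10_main_of_up_eq hup (upOfRecord₅C_pinB10_b10_iff F N σ P) hUV

/-- … exact reading there. [cite: Balaban1985UV3, Thm 1 p.257 + Thm 2 p.272 (bookkeeping)] -/
theorem b10_leaf_iff_of_up_pinB10 {P : B12.RunParams} (hup : w.up P = upOfRecord₅C F N (σ.pinB10 F N) P) : (leavesP w P).b10 ↔ PrintedUV3V N σ.L :=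
  b10_leaf_iff_of_up_eq hup (upOfRecord₅C_pinB10_b10_iff F N σ P)

/-- **N08 AT EVERY RUN OF A WORLD BOUND OVER A FOUR-PIN VIEW** `(((σ.pinB10).pinY Y₀).pinZ Z₀).pinW W₀`, from `PrintedUV3V N σ.L`. [cite: Balaban1985UV3, Thm 1 p.257 (compact reading) + Thm 2 p.272; Balaban1989LargeFieldII, Thm 1 + (0.1) pp.355–356 (bookkeeping)] -/
theorem b10_main_of_up_pin4 (Y₀ : PrintedCarriers9X) (Z₀ : PrintedCarriers11) (W₀ : B12.RunParams → PrintedCarriers15)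
    (hup : ∀ P, w.up P = upOfRecord₅C F N ((((σ.pinB10 F N).pinY F N Y₀).pinZ F N Z₀).pinW F N W₀) P) (hUV : PrintedUV3V N σ.L) (P : B12.RunParams) :
    Dag.B10_main (leavesP w P) :=
  b10_main_of_up_eq (hup P) (b10Face_pin4 σ Y₀ Z₀ W₀ P) hUV

/-- … exact reading there. [cite: Balaban1985UV3, Thm 1 p.257 + Thm 2 p.272 (bookkeeping)] -/
theorem b10_leaf_iff_of_up_pin4 (Y₀ : PrintedCarriers9X) (Z₀ : PrintedCarriers11) (W₀ : B12.RunParams → PrintedCarriers15)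
    (hup : ∀ P, w.up P = upOfRecord₅C F N ((((σ.pinB10 F N).pinY F N Y₀).pinZ F N Z₀).pinW F N W₀) P) (P : B12.RunParams) :
    (leavesP w P).b10 ↔ PrintedUV3V N σ.L :=
  b10_leaf_iff_of_up_eq (hup P) (b10Face_pin4 σ Y₀ Z₀ W₀ P)

/-- … exact cost there: N08 ⟺ «in-edge leaves → `PrintedUV3V N σ.L`». [cite: Balaban1985UV3, Thm 1 p.257 + Thm 2 p.272 (bookkeeping)] -/
theorem b10_main_iff_of_up_pin4 (Y₀ : PrintedCarriers9X) (Z₀ : PrintedCarriers11) (W₀ : B12.RunParams → PrintedCarriers15)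
    (hup : ∀ P, w.up P = upOfRecord₅C F N ((((σ.pinB10 F N).pinY F N Y₀).pinZ F N Z₀).pinW F N W₀) P) (P : B12.RunParams) :
    Dag.B10_main (leavesP w P) ↔
      ((leavesP w P).b5 → (leavesP w P).b6 → (leavesP w P).b7 → (leavesP w P).b8 → (leavesP w P).b9 → (leavesP w P).b11 → PrintedUV3V N σ.L) :=
  b10_main_iff_of_up_eq (hup P) (b10Face_pin4 σ Y₀ Z₀ W₀ P)

/-- **N08 AT EVERY RUN OF A WORLD BOUND (C-binding) OVER THE [B8]-INNER FIVE-PIN VIEW**, from `PrintedUV3V N σ.L`. [cite: Balaban1985UV3, Thm 1 p.257 (compact reading) + Thm 2 p.272; Balaban1989LargeFieldII, Thm 1 + (0.1) pp.355–356 (bookkeeping)] -/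
theorem b10_main_of_up_pinB8_pin4 (lam : ResidB8 σ.toStage3Params) (Y₀ : PrintedCarriers9X) (Z₀ : PrintedCarriers11)
    (W₀ : B12.RunParams → PrintedCarriers15)
    (hup : ∀ P, w.up P = upOfRecord₅C F N (((((σ.pinB8 F N lam).pinB10 F N).pinY F N Y₀).pinZ F N Z₀).pinW F N W₀) P) (hUV : PrintedUV3V N σ.L)
    (P : B12.RunParams) : Dag.B10_main (leavesP w P) :=
  b10_main_of_up_eq (hup P) (b10Face_pinB8_pin4 σ lam Y₀ Z₀ W₀ P) hUV

/-- **N08 AT EVERY RUN OF A WORLD BOUND (S-binding) OVER THE [B8]-INNER FIVE-PIN VIEW** (the world shape of the `…CB10YZWB8` keys), from `PrintedUV3V N σ.L`.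
[cite: Balaban1985UV3, Thm 1 p.257 (compact reading) + Thm 2 p.272; Balaban1985RegularSpaces, Thm 8 p.101; Balaban1989LargeFieldII, Thm 1 + (0.1) pp.355–356 (bookkeeping)] -/
theorem b10_main_of_upS_pinB8_pin4 (lam : ResidB8 σ.toStage3Params) (Y₀ : PrintedCarriers9X) (Z₀ : PrintedCarriers11)
    (W₀ : B12.RunParams → PrintedCarriers15)
    (hup : ∀ P, w.up P = upOfRecord₅CS F N (((((σ.pinB8 F N lam).pinB10 F N).pinY F N Y₀).pinZ F N Z₀).pinW F N W₀) P) (hUV : PrintedUV3V N σ.L)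
    (P : B12.RunParams) : Dag.B10_main (leavesP w P) :=
  b10_main_of_up_eq (hup P) (b10FaceS_pinB8_pin4 σ lam Y₀ Z₀ W₀ P) hUV

/-- … exact reading there. [cite: Balaban1985UV3, Thm 1 p.257 + Thm 2 p.272 (bookkeeping)] -/
theorem b10_leaf_iff_of_upS_pinB8_pin4 (lam : ResidB8 σ.toStage3Params) (Y₀ : PrintedCarriers9X) (Z₀ : PrintedCarriers11)
    (W₀ : B12.RunParams → PrintedCarriers15)
    (hup : ∀ P, w.up P = upOfRecord₅CS F N (((((σ.pinB8 F N lam).pinB10 F N).pinY F N Y₀).pinZ F N Z₀).pinW F N W₀) P) (P : B12.RunParams) :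
    (leavesP w P).b10 ↔ PrintedUV3V N σ.L :=
  b10_leaf_iff_of_up_eq (hup P) (b10FaceS_pinB8_pin4 σ lam Y₀ Z₀ W₀ P)

end Pointed

/-! ## §4 THE EXISTING CUMULATIVE VIEWS ARE INSTANCES (kernel `rfl`): g31's Stage-10 and g32's Stage-12 four-pin views are the four-pin word at `σ := θ.toStage5ₙ` -/

section Instances10
variable (θ : Stage9Params F N) (Mstar : ℕ) (ops : OpsY N θ.toStage3Params Mstar) (ζ : ResidZ F N) (lamW : ResidW F N)

/-- g31's `Stage9Params.view₁₀B10YZW` IS the four-pin word over `θ.toStage5₁₀` (`rfl`). [cite: Balaban1989LargeFieldII, Thm 1 p.355 (bookkeeping)] -/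
theorem view₁₀B10YZW_eq_pin4 :
    θ.view₁₀B10YZW F N Mstar ops ζ lamW =
      ((((θ.toStage5₁₀ F N).pinB10 F N).pinY F N (Y9OfRecord N θ.toStage3Params Mstar ops)).pinZ F N (Z11OfRecord F N ζ)).pinW F N (WOfRecord₁₀ F N θ lamW) :=
  rfl

/-- Instance: N08 at a world bound over the Stage-10 four-pin view, by §3 (`exact`; = this seat's `N08AtRecord10CB10YZ` ∕ `N08AtRecord11` recipe, re-derived generically).
[cite: Balaban1985UV3, Thm 1 p.257 + Thm 2 p.272 (bookkeeping)] -/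
theorem b10_main_of_up_view₁₀B10YZW {w : WorldP} (hup : ∀ P, w.up P = upOfRecord₅C F N (θ.view₁₀B10YZW F N Mstar ops ζ lamW) P) (hUV : PrintedUV3V N θ.L)
    (P : B12.RunParams) : Dag.B10_main (leavesP w P) :=
  b10_main_of_up_pin4 (θ.toStage5₁₀ F N) _ _ _ hup hUV P

end Instances10

section Instances12
variable (θ : Stage12Params F N) (Mstar : ℕ) (ops : OpsY N θ.toStage3Params Mstar) (ζ : ResidZ F N) (lamW : ResidW F N)

/-- g32's `Stage12Params.view₁₂B10YZW` IS the four-pin word over `θ.toStage5₁₂` (`rfl`) — so §3 re-proves this seat's `N08StubNodes12Currency.b10_main_of_upC_view₁₂B10YZW` by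
`exact`, and the Stage-13 view (when the ₁₃ carrier module names it) likewise. [cite: Balaban1989LargeFieldII, Thm 1 p.355 (bookkeeping)] -/
theorem view₁₂B10YZW_eq_pin4 :
    θ.view₁₂B10YZW F N Mstar ops ζ lamW =
      ((((θ.toStage5₁₂ F N).pinB10 F N).pinY F N (Y9OfRecord N θ.toStage3Params Mstar ops)).pinZ F N (Z11OfRecord F N ζ)).pinW F N (WOfRecord₁₂ F N θ lamW) :=
  rfl

/-- Instance: N08 at a world bound over g32's Stage-12 four-pin view, by §3 (`exact`). [cite: Balaban1985UV3, Thm 1 p.257 + Thm 2 p.272 (bookkeeping)] -/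
theorem b10_main_of_up_view₁₂B10YZW {w : WorldP} (hup : ∀ P, w.up P = upOfRecord₅C F N (θ.view₁₂B10YZW F N Mstar ops ζ lamW) P) (hUV : PrintedUV3V N θ.L)
    (P : B12.RunParams) : Dag.B10_main (leavesP w P) :=
  b10_main_of_up_pin4 (θ.toStage5₁₂ F N) _ _ _ hup hUV P

/-- Instance: N08 at a world bound BY THE S-BINDING over g32's five-pin view with [B8] (`view₁₂B8B10YZW = (θ.pinB8 λ).view₁₂B10YZW`; the world of a `₁₂CB10YZWB8` record), by §3.
[cite: Balaban1985UV3, Thm 1 p.257 + Thm 2 p.272; Balaban1985RegularSpaces, Thm 8 p.101 (bookkeeping)] -/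
theorem b10_main_of_upS_view₁₂B8B10YZW {w : WorldP} (lam : ResidB8 θ.toStage3Params)
    (hup : ∀ P, w.up P = upOfRecord₅CS F N (θ.view₁₂B8B10YZW F N lam Mstar ops ζ lamW) P) (hUV : PrintedUV3V N θ.L) (P : B12.RunParams) :
    Dag.B10_main (leavesP w P) :=
  b10_main_of_up_eq (hup P) (b10FaceS_of_b10Face (b10Face_pin4 ((θ.pinB8 F N lam).toStage5₁₂ F N) _ _ _ P)) hUV

end Instances12

end Summit.QuantumFields.YangMills.BalabanUVNodes.N08AtStage5View

end
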